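import Literature.NumberTheory.Transcendental.BrownLevelOneProofs
import Literature.NumberTheory.Transcendental.MultipleZetaValuesDimBoundProofs
import Literature.NumberTheory.Transcendental.MultipleZetaThreeOneProofs
import Mathlib.Data.List.Lex
import HarnessLib

/-!
# Brown, *Mixed Tate motives over ℤ* (2012) — §§5–7: the level filtration, the deconcatenation
# matrices of Corollary 6.2, and Theorem 7.3 in all levels

Sibling file in the cone of the named fact
`Literature.NumberTheory.Transcendental.hoffmanSpan_eq_mzvSpace` (Brown 2012, Theorem 1.1),
vendoring the combinatorial and arithmetic content of §5 (level filtration, the index sets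
`B_{N,ℓ}`, `B'_{N,ℓ}` and the matrices `M_{N,ℓ}`), §6 (Corollary 6.2: upper-triangularity of the
deconcatenation part) and §7 (Theorem 7.3: invertibility of `M_{N,ℓ}`) of Brown's proof, for ALL
weights `N` and levels `ℓ ≥ 1`. The only motivic input of this part of the paper is
**Theorem 6.1**: modulo the submodule `I` (generated by `C_w - C_{w̃}` and `C_{12^k}`), the map
`∂^f_{N,ℓ}` acts on `ζᵐ(w)` by deconcatenation, `∑_{w = uv, deg₃ v = 1} C_v ζᵐ(u)`; since
`μ(I) ⊆ 2ℤ` (Corollary 4.4 (1) and Lemma 3.8: `c_w - c_{w̃} ∈ 2ℤ`, `c_{12^k} = 2(-1)^k`), it says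
that the matrix `M_{N,ℓ}` of `∂_{N,ℓ}` is the **deconcatenation matrix**
`T_{N,ℓ} = (∑_{w=uv, deg₃ v=1} c_v)_{w,u}` plus a matrix with even-integer (more precisely
`2ℤ₍₂₎`-valued) entries. We define `T_{N,ℓ}` (`Brown2012.levelMatrix`, rows `B_{N,ℓ}` realised
through the bijection (6.2) `u ↦ u 3 2^{r-1}` from `B'_{N,ℓ}`, columns `B'_{N,ℓ}`) and PROVE:

* `Brown2012.phi_bijective` — (6.2) is a bijection `B'_{N,ℓ} → B_{N,ℓ}` (Corollary 6.2);
* `Brown2012.levelMatrix_below/diag/above` — **Corollary 6.2**: `T_{N,ℓ}` is upper-triangular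
  (for the order of Definition 5.8; only "a proper prefix precedes its extensions" matters, see
  below), with diagonal entries `c_{3 2^{r-1}}` and the entries above the diagonal in the column of
  `u` equal to `0` or `c_{2^{a} 3 2^{b}}`, `a + b + 1 = r`;
* `Brown2012.isUnit_levelMatrix_add` — **Theorem 7.3 (all `N`, `ℓ`), through the interface of
  Theorem 6.1**: for every matrix `E` whose entries are `0` or of `2`-adic valuation `≥ 1` (as are
  the entries of `μ(M^f_{N,ℓ} - T^f_{N,ℓ}) ∈ μ(I) ⊆ 2ℤ`), `T_{N,ℓ} + E` is invertible — by the
  `2`-adic Lemma 7.1 (`Brown2012.lemma_7_1`) and Corollary 4.4 (2)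
  (`padicValRat_zagierCoeff_three_twos_le`, `…_le_zero`); in particular `T_{N,ℓ}` itself is
  invertible (`Brown2012.isUnit_levelMatrix`);
* `Brown2012.sum_zagierCoeff_antidiagonal` — the real-coefficient form of Lemma 3.8 / (3.11):
  `∑_{a+b=n-1} c_{2^{a} 3 2^{b}} = (-1)^{n+1}`, i.e. `c_{12ⁿ} := -2 ∑ᵢ c_{2^{i} 3 2^{n-1-i}} = 2(-1)ⁿ`
  (so that indeed `μ(C_{12ⁿ}) ∈ 2ℤ`).

Orders. Definition 5.8 orders `B_{N,ℓ}` and `B'_{N,ℓ}` in reverse lexicographic order for `3 < 2`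
and (6.2) preserves it. For the triangularity only the following is used (proof of Cor. 6.2): the
non-zero deconcatenation entries in the column of `u` sit in the rows `u 2^{a} 3 2^{b}`, and
`u 2^{a} 3 2^{b} ≤ u 3 2^{r-1}`, i.e. `u 2^{a} ≼ u` in `B'`: an extension of a word precedes it. We
therefore index rows and columns by `B'_{N,ℓ}` with the ORDER DUAL of the lexicographic order of
`List ℕ` (in which a proper prefix is smaller), which has this property; Lemma 7.1 applies verbatim.

No named facts are introduced; the definitions are `Brown2012.level`, `Brown2012.ColWord`
(`= B'_{N,ℓ}`), `Brown2012.RowWord` (`= B_{N,ℓ}`), `Brown2012.phi` ((6.2)),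
`Brown2012.coeffOfLevelOne` (`v = 2^{a} 3 2^{b} ↦ c_v`), `Brown2012.deconcEntry` and
`Brown2012.levelMatrix` (D-0026).

## References

* F. Brown, *Mixed Tate motives over ℤ*, Ann. of Math. **175** (2012), 949–976: Definitions
  5.4, 5.8, 5.9, (5.7), Theorem 6.1, (6.2), Corollary 6.2, Lemma 7.1, Theorem 7.3, Lemma 3.8,
  (3.11) (arXiv:1102.1312, pp. 13–18). [Brown2012]
-/

noncomputable section

open scoped BigOperators

namespace Literature.NumberTheory.Transcendental

namespace Brown2012

open MZV

/-! ### Level, the index sets `B'_{N,ℓ}`, `B_{N,ℓ}`, and the bijection (6.2) -/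

/-- The **level** `deg₃ w` of a word: the number of letters `3` (Brown 2012, Definition 5.4).
[cite: Brown2012, Definition 5.4] -/
def level (w : List ℕ) : ℕ := w.count 3

/-- `deg₃` is additive under concatenation. [folklore] -/
@[simp] theorem level_append (u v : List ℕ) : level (u ++ v) = level u + level v := by
  simp [level, List.count_append]

/-- `deg₃ (2^{a}) = 0`. [folklore] -/
@[simp] theorem level_replicate_two (a : ℕ) : level (List.replicate a 2) = 0 := by
  simp [level, List.count_replicate]

/-- `deg₃ (3 :: w) = deg₃ w + 1`. [folklore] -/
@[simp] theorem level_cons_three (w : List ℕ) : level (3 :: w) = level w + 1 := by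
  simp [level]

/-- `deg₃ (2 :: w) = deg₃ w`. [folklore] -/
@[simp] theorem level_cons_two (w : List ℕ) : level (2 :: w) = level w := by
  simp [level]

/-- A Hoffman word of level `0` is `2^{a}`. [folklore] -/
theorem eq_replicate_two_of_level_eq_zero {x : List ℕ} (hx : IsHoffman x) (h0 : level x = 0) :
    x = List.replicate x.length 2 := by
  refine List.eq_replicate_iff.2 ⟨rfl, fun b hb => ?_⟩
  rcases hx b hb with rfl | rfl
  · rfl
  · exact absurd (List.count_pos_iff.2 hb) (by simp [level] at h0; omega)

/-- The column index set `B'_{N,ℓ}` of `M_{N,ℓ}` (Brown 2012, Definition 5.8): Hoffman words `u`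
of level `ℓ - 1` and weight `< N - 1`, here with the weight written `N = |u| + 2r + 1`, `r ≥ 1`
(the parity `N - |u|` odd is automatic when `B_{N,ℓ} ≠ ∅`, as `N ≡ 3ℓ ≡ |u| + 3 (mod 2)`).
[cite: Brown2012, Definition 5.8] -/
abbrev ColWord (N ℓ : ℕ) : Type :=
  {u : List ℕ // IsHoffman u ∧ level u + 1 = ℓ ∧ weight u + 3 ≤ N ∧ (N - weight u) % 2 = 1}

/-- The row index set `B_{N,ℓ}` (Brown 2012, Definition 5.8): Hoffman words of weight `N` and
level `ℓ`. [cite: Brown2012, Definition 5.8] -/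
abbrev RowWord (N ℓ : ℕ) : Type := {w : List ℕ // IsHoffman w ∧ weight w = N ∧ level w = ℓ}

/-- The number `b = r - 1` of trailing `2`s of the row word attached to a column word `u`:
`N = |u| + 3 + 2b`. [cite: Brown2012, (6.2)] -/
def twosAfter (N : ℕ) (u : List ℕ) : ℕ := (N - weight u - 3) / 2

/-- The map (6.2) `u ↦ u 3 2^{r-1}` from `B'_{N,ℓ}` to `B_{N,ℓ}` (on words). [cite: Brown2012, (6.2)] -/
def phi (N : ℕ) (u : List ℕ) : List ℕ := u ++ 3 :: List.replicate (twosAfter N u) 2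

/-- `|u 3 2^{b}| = |u| + 3 + 2b`. [folklore] -/
theorem weight_append_three_twos (u : List ℕ) (b : ℕ) :
    weight (u ++ 3 :: List.replicate b 2) = weight u + 3 + 2 * b := by
  simp only [weight, List.sum_append, List.sum_cons, List.sum_replicate, smul_eq_mul]
  ring

/-- `2^{b} 3 x = 2^{b'} 3 y` forces `b = b'` and `x = y`. [folklore] -/
theorem replicate_two_append_three_inj : ∀ {b b' : ℕ} {x y : List ℕ},
    List.replicate b 2 ++ 3 :: x = List.replicate b' 2 ++ 3 :: y → b = b' ∧ x = y
  | 0, 0, x, y, h => by simpa using h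
  | 0, b' + 1, x, y, h => by simp [List.replicate_succ] at h
  | b + 1, 0, x, y, h => by simp [List.replicate_succ] at h
  | b + 1, b' + 1, x, y, h => by
      simp only [List.replicate_succ, List.cons_append, List.cons.injEq, true_and] at h
      obtain ⟨h1, h2⟩ := replicate_two_append_three_inj h
      exact ⟨by omega, h2⟩

/-- `u 3 2^{b} = u' 3 2^{b'}` forces `u = u'` and `b = b'` (split at the last `3`). [folklore] -/
theorem append_three_twos_inj {u u' : List ℕ} {b b' : ℕ}
    (h : u ++ 3 :: List.replicate b 2 = u' ++ 3 :: List.replicate b' 2) : u = u' ∧ b = b' := by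
  have hr := congrArg List.reverse h
  simp only [List.reverse_append, List.reverse_cons, List.reverse_replicate, List.append_assoc,
    List.singleton_append] at hr
  obtain ⟨h1, h2⟩ := replicate_two_append_three_inj hr
  exact ⟨List.reverse_injective h2, h1⟩

/-- `u 3 2^{r-1}` is a Hoffman word of weight `N` and level `deg₃ u + 1`. [cite: Brown2012, (6.2)] -/
theorem phi_mem {N ℓ : ℕ} (u : ColWord N ℓ) :
    IsHoffman (phi N u.1) ∧ weight (phi N u.1) = N ∧ level (phi N u.1) = ℓ := by
  obtain ⟨u, hu, hl, hw, hp⟩ := u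
  dsimp only
  refine ⟨?_, ?_, ?_⟩
  · intro i hi
    simp only [phi, List.mem_append, List.mem_cons] at hi
    rcases hi with h | rfl | h
    · exact hu i h
    · exact Or.inr rfl
    · exact Or.inl (List.eq_of_mem_replicate h)
  · rw [phi, weight_append_three_twos, twosAfter]
    omega
  · simp only [phi, level_append, level_cons_three, level_replicate_two]
    omega

/-- (6.2) as a map `B'_{N,ℓ} → B_{N,ℓ}`. [cite: Brown2012, (6.2)] -/
def phiRow {N ℓ : ℕ} (u : ColWord N ℓ) : RowWord N ℓ := ⟨phi N u.1, phi_mem u⟩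

/-- Every Hoffman word of level `≥ 1` is uniquely `u 3 2^{b}` with `u` Hoffman (split at the last
`3`). [folklore] -/
theorem exists_eq_append_three_twos {w : List ℕ} (hw : IsHoffman w) (hl : 1 ≤ level w) :
    ∃ u b, IsHoffman u ∧ w = u ++ 3 :: List.replicate b 2 := by
  induction w with
  | nil => simp [level] at hl
  | cons a w ih =>
    have ha : a = 2 ∨ a = 3 := hw a (by simp)
    have hw' : IsHoffman w := fun i hi => hw i (by simp [hi])
    by_cases hlw : 1 ≤ level w
    · obtain ⟨u, b, hu, rfl⟩ := ih hw' hlw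
      refine ⟨a :: u, b, fun i hi => ?_, by simp⟩
      simp only [List.mem_cons] at hi
      rcases hi with rfl | hi
      · exact ha
      · exact hu i hi
    · have h0 : level w = 0 := by omega
      rcases ha with rfl | rfl
      · exfalso
        rw [level_cons_two] at hl
        omega
      · refine ⟨[], w.length, fun i hi => by simp at hi, ?_⟩
        rw [List.nil_append, ← eq_replicate_two_of_level_eq_zero hw' h0]

/-- **(6.2) is a bijection `B'_{N,ℓ} → B_{N,ℓ}`** (Brown 2012, proof of Corollary 6.2: "This map is
a bijection"). [cite: Brown2012, Corollary 6.2] -/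
theorem phiRow_bijective (N ℓ : ℕ) (hℓ : 1 ≤ ℓ) : Function.Bijective (phiRow (N := N) (ℓ := ℓ)) := by
  constructor
  · rintro ⟨u, hu⟩ ⟨u', hu'⟩ h
    simp only [phiRow, Subtype.mk.injEq, phi] at h
    exact Subtype.ext (append_three_twos_inj h).1
  · rintro ⟨w, hw, hwt, hwl⟩
    have hl1 : 1 ≤ level w := by rw [hwl]; exact hℓ
    obtain ⟨u, b, hu, rfl⟩ := exists_eq_append_three_twos hw hl1
    have hb : weight u + 3 + 2 * b = N := by rw [weight_append_three_twos] at hwt; exact hwt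
    have hlu : level u + 1 = ℓ := by
      simp only [level_append, level_cons_three, level_replicate_two] at hwl
      omega
    have h3 : weight u + 3 ≤ N := by rw [← hb]; omega
    have h4 : (N - weight u) % 2 = 1 := by rw [← hb]; omega
    refine ⟨⟨u, hu, hlu, h3, h4⟩, ?_⟩
    simp only [phiRow, phi, twosAfter, Subtype.mk.injEq]
    rw [← hb, show weight u + 3 + 2 * b - weight u - 3 = 2 * b by omega, Nat.mul_div_cancel_left b two_pos]

/-- `B'_{N,ℓ}` is finite. [folklore] -/
instance finite_colWord (N ℓ : ℕ) : Finite (ColWord N ℓ) := by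
  have hfin : Set.Finite {u : List ℕ | IsHoffman u ∧ weight u < N} := by
    have hU : {u : List ℕ | IsHoffman u ∧ weight u < N} =
        ⋃ k ∈ Finset.range N, {s : List ℕ | IsHoffman s ∧ weight s = k} := by
      ext u
      simp only [Set.mem_setOf_eq, Set.mem_iUnion, Finset.mem_range, exists_prop]
      constructor
      · rintro ⟨h1, h2⟩; exact ⟨_, h2, h1, rfl⟩
      · rintro ⟨k, hk, h1, rfl⟩; exact ⟨h1, hk⟩
    rw [hU]
    refine Set.Finite.biUnion (Finset.finite_toSet _) fun k _ => Set.finite_coe_iff.mp ?_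
    exact finite_hoffman k
  exact (hfin.subset fun u hu => ⟨hu.1, by have := hu.2.2.1; omega⟩).to_subtype

/-- `B'_{N,ℓ}` as a finite type. [folklore] -/
noncomputable instance fintype_colWord (N ℓ : ℕ) : Fintype (ColWord N ℓ) := Fintype.ofFinite _

/-! ### Prefixes and the lexicographic order -/

/-- A word is not lexicographically smaller than any of its prefixes (a proper prefix is smaller).
[folklore] -/
theorem not_lt_of_prefix : ∀ {l₁ l₂ : List ℕ}, l₁ <+: l₂ → ¬ l₂ < l₁
  | [], l₂, _ => by simp
  | a :: l₁, l₂, h => by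
      obtain ⟨t, rfl⟩ := h
      intro hlt
      rw [List.cons_append, List.cons_lt_cons_iff] at hlt
      rcases hlt with h | ⟨-, h⟩
      · exact lt_irrefl _ h
      · exact not_lt_of_prefix (List.prefix_append l₁ t) h

/-! ### The deconcatenation matrix `T_{N,ℓ}` (Theorem 6.1 / Corollary 6.2) -/

/-- `c_v` for a word `v = 2^{a} 3 2^{b}` of level one: `zagierCoeff a b` (`a` = position of the
letter `3`). [cite: Brown2012, Theorem 4.3 eq. (4.2)] -/
def coeffOfLevelOne (v : List ℕ) : ℚ := zagierCoeff (v.idxOf 3) (v.length - v.idxOf 3 - 1)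

/-- `c_{2^{a} 3 2^{b}} = zagierCoeff a b`. [folklore] -/
theorem coeffOfLevelOne_eq (a b : ℕ) :
    coeffOfLevelOne (List.replicate a 2 ++ 3 :: List.replicate b 2) = zagierCoeff a b := by
  unfold coeffOfLevelOne
  have hi : (List.replicate a 2 ++ 3 :: List.replicate b 2).idxOf 3 = a := by
    rw [List.idxOf_append_of_notMem (by simp), List.idxOf_cons_self, List.length_replicate, Nat.add_zero]
  rw [hi]
  congr 1
  simp

/-- The deconcatenation entry `(T)_{w,u} = ∑_{w = uv, deg₃ v = 1} c_v` (there is at most one such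
`v`): `c_v` if `u` is a prefix of `w` with cofactor `v` of level one, else `0`
(Brown 2012, Theorem 6.1). [cite: Brown2012, Theorem 6.1] -/
def deconcEntry (w u : List ℕ) : ℚ :=
  if u <+: w ∧ level (w.drop u.length) = 1 then coeffOfLevelOne (w.drop u.length) else 0

/-- **The deconcatenation matrix `T_{N,ℓ}`** — the matrix of Theorem 6.1's right-hand side
`ζᵐ(w) ↦ ∑_{w=uv, deg₃ v=1} c_v ζᵐ(u)`, rows `w ∈ B_{N,ℓ}` realised as `w = u' 3 2^{r'-1}` through the
bijection (6.2), columns `u ∈ B'_{N,ℓ}`; both indexed by `B'_{N,ℓ}` with the order DUAL to the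
lexicographic order of words (extensions first, as in Definition 5.8). By Theorem 6.1,
`M_{N,ℓ} ≡ T_{N,ℓ}` modulo matrices with entries in `μ(I) ⊆ 2ℤ`.
[cite: Brown2012, Theorem 6.1 and Definition 5.9] -/
def levelMatrix (N ℓ : ℕ) : Matrix (ColWord N ℓ)ᵒᵈ (ColWord N ℓ)ᵒᵈ ℚ :=
  Matrix.of fun i j => deconcEntry (phi N (OrderDual.ofDual i).1) (OrderDual.ofDual j).1

/-- Unfolding `levelMatrix`. [folklore] -/
theorem levelMatrix_apply (N ℓ : ℕ) (i j : (ColWord N ℓ)ᵒᵈ) :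
    levelMatrix N ℓ i j = deconcEntry (phi N (OrderDual.ofDual i).1) (OrderDual.ofDual j).1 := rfl

variable {N ℓ : ℕ}

/-- If `u ∈ B'_{N,ℓ}` is a prefix of `u' ∈ B'_{N,ℓ}` then `u' = u 2^{a}` (same level).
[cite: Brown2012, proof of Corollary 6.2] -/
theorem eq_append_replicate_of_prefix (u' u : ColWord N ℓ) (h : u.1 <+: u'.1) :
    u'.1 = u.1 ++ List.replicate (u'.1.length - u.1.length) 2 := by
  obtain ⟨x, hx⟩ := h
  have hxH : IsHoffman x := fun i hi => u'.2.1 i (by rw [← hx]; simp [hi])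
  have hxl : level x = 0 := by
    have h1 := u'.2.2.1
    have h2 := u.2.2.1
    rw [← hx, level_append] at h1
    omega
  have hxe := eq_replicate_two_of_level_eq_zero hxH hxl
  rw [← hx, List.length_append, Nat.add_sub_cancel_left, ← hxe]

/-- **The entries of `T_{N,ℓ}`** (proof of Corollary 6.2): in the row of `u' 3 2^{b'}` and the
column of `u`, the entry is `c_{2^{a} 3 2^{b'}}` if `u' = u 2^{a}`, and `0` if `u` is not a prefix
of `u'`. [cite: Brown2012, Corollary 6.2] -/
theorem deconcEntry_phi (u' u : ColWord N ℓ) :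
    deconcEntry (phi N u'.1) u.1 =
      if u.1 <+: u'.1 then zagierCoeff (u'.1.length - u.1.length) (twosAfter N u'.1) else 0 := by
  unfold deconcEntry
  by_cases h : u.1 <+: u'.1
  · have he := eq_append_replicate_of_prefix u' u h
    have hpre : u.1 <+: phi N u'.1 := h.trans (List.prefix_append _ _)
    have hdrop : (phi N u'.1).drop u.1.length =
        List.replicate (u'.1.length - u.1.length) 2 ++ 3 :: List.replicate (twosAfter N u'.1) 2 := by
      rw [phi]
      nth_rewrite 1 [he]
      rw [List.append_assoc, List.drop_left]
    rw [if_pos h, hdrop, if_pos ⟨hpre, by simp⟩, coeffOfLevelOne_eq]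
  · rw [if_neg h, if_neg]
    rintro ⟨hpre, hlev⟩
    -- `u` is a prefix of `u' 3 2^{b'}` but not of `u'`: then `u = u' 3 …`, of larger level
    rcases le_or_gt u.1.length u'.1.length with hle | hgt
    · exact h (List.prefix_of_prefix_length_le hpre (List.prefix_append _ _) hle)
    · have h' : u'.1 <+: u.1 :=
        List.prefix_of_prefix_length_le (List.prefix_append _ _) hpre hgt.le
      obtain ⟨s, hs⟩ := h'
      have hs' : s <+: 3 :: List.replicate (twosAfter N u'.1) 2 := by
        have : u'.1 ++ s <+: u'.1 ++ 3 :: List.replicate (twosAfter N u'.1) 2 := by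
          rw [hs]; exact hpre
        exact (List.prefix_append_right_inj u'.1).1 this
      rcases s with _ | ⟨c, s⟩
      · rw [List.append_nil] at hs
        exact h (hs ▸ List.prefix_rfl)
      · obtain ⟨rfl, -⟩ := List.cons_prefix_cons.1 hs'
        have h1 := u'.2.2.1
        have h2 := u.2.2.1
        rw [← hs, level_append, level_cons_three] at h2
        omega

/-- **Corollary 6.2, below the diagonal**: `T_{N,ℓ}` is upper-triangular — if the column word
precedes the row word (`j < i`, extensions first) the entry vanishes. [cite: Brown2012, Corollary 6.2] -/
theorem levelMatrix_below (i j : (ColWord N ℓ)ᵒᵈ) (hij : j < i) : levelMatrix N ℓ i j = 0 := by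
  rw [levelMatrix_apply, deconcEntry_phi, if_neg]
  intro hp
  have hlt : (OrderDual.ofDual i).1 < (OrderDual.ofDual j).1 := OrderDual.ofDual_lt_ofDual.2 hij
  exact not_lt_of_prefix hp hlt

/-- **Corollary 6.2, the diagonal**: the diagonal entry in the column of `u` is `c_{3 2^{r-1}}`
(`= zagierCoeff 0 (r-1)`). [cite: Brown2012, Corollary 6.2] -/
theorem levelMatrix_diag (j : (ColWord N ℓ)ᵒᵈ) :
    levelMatrix N ℓ j j = zagierCoeff 0 (twosAfter N (OrderDual.ofDual j).1) := by
  rw [levelMatrix_apply, deconcEntry_phi, if_pos List.prefix_rfl, Nat.sub_self]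

/-- **Corollary 6.2, above the diagonal**: a non-zero entry in the column of `u` is
`c_{2^{a} 3 2^{b}}` with `a + b + 1 = r` (the `r` of the column: `N = |u| + 2r + 1`).
[cite: Brown2012, Corollary 6.2] -/
theorem levelMatrix_eq_zagierCoeff_of_prefix (i j : (ColWord N ℓ)ᵒᵈ)
    (hp : (OrderDual.ofDual j).1 <+: (OrderDual.ofDual i).1) :
    levelMatrix N ℓ i j =
      zagierCoeff ((OrderDual.ofDual i).1.length - (OrderDual.ofDual j).1.length)
        (twosAfter N (OrderDual.ofDual i).1) ∧
    (OrderDual.ofDual i).1.length - (OrderDual.ofDual j).1.length + twosAfter N (OrderDual.ofDual i).1 =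
      twosAfter N (OrderDual.ofDual j).1 := by
  refine ⟨by rw [levelMatrix_apply, deconcEntry_phi, if_pos hp], ?_⟩
  have he := eq_append_replicate_of_prefix (OrderDual.ofDual i) (OrderDual.ofDual j) hp
  have hw : weight (OrderDual.ofDual i).1 = weight (OrderDual.ofDual j).1 +
      2 * ((OrderDual.ofDual i).1.length - (OrderDual.ofDual j).1.length) := by
    conv_lhs => rw [he]
    simp [weight, List.sum_replicate, mul_comm]
  have h1 := (OrderDual.ofDual i).2.2.2
  have h2 := (OrderDual.ofDual j).2.2.2
  simp only [twosAfter]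
  omega

/-- If `u` is not a prefix of the row word, the entry is `0`. [cite: Brown2012, Corollary 6.2] -/
theorem levelMatrix_eq_zero_of_not_prefix (i j : (ColWord N ℓ)ᵒᵈ)
    (hp : ¬ (OrderDual.ofDual j).1 <+: (OrderDual.ofDual i).1) : levelMatrix N ℓ i j = 0 := by
  rw [levelMatrix_apply, deconcEntry_phi, if_neg hp]

/-! ### Theorem 7.3 in all levels -/

/-- Adding `0` or a rational of `2`-adic valuation `≥ 1` to a non-zero rational of valuation `≤ 0`
changes neither its non-vanishing nor its valuation. [folklore] -/
theorem padicValRat_add_of_zero_or_one_le {c e : ℚ} (hc : c ≠ 0) (hv : padicValRat 2 c ≤ 0)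
    (he : e = 0 ∨ 1 ≤ padicValRat 2 e) : c + e ≠ 0 ∧ padicValRat 2 (c + e) = padicValRat 2 c := by
  rcases he with rfl | he
  · simp [hc]
  · have he0 : e ≠ 0 := by
      rintro rfl
      simp at he
    have hlt : padicValRat 2 c < padicValRat 2 e := by omega
    have hsum : c + e ≠ 0 := by
      intro h0
      have hce : c = -e := by linear_combination h0
      rw [hce, padicValRat.neg] at hlt
      exact lt_irrefl _ hlt
    exact ⟨hsum, padicValRat.add_eq_of_lt hsum hc he0 hlt⟩

/-- **Brown 2012, Theorem 7.3 (all weights and levels), through the interface of Theorem 6.1**: for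
every matrix `E` with entries `0` or of `2`-adic valuation `≥ 1` — as is `μ(M^f_{N,ℓ} - T^f_{N,ℓ})`,
whose entries lie in `μ(I) ⊆ 2ℤ` by Theorem 6.1, Corollary 4.4 (1) and Lemma 3.8 — the matrix
`T_{N,ℓ} + E` is invertible. Proof: Brown's — conditions (7.1) of Lemma 7.1 for `p = 2`: below the
diagonal the entries are those of `E` (Corollary 6.2); in the column of `u` the diagonal entry has
valuation `v₂(c_{3 2^{r-1}}) ≤ 0`, the least of its column (Corollary 4.4 (2)).
[cite: Brown2012, Theorem 7.3] -/
theorem isUnit_levelMatrix_add (N ℓ : ℕ) (E : Matrix (ColWord N ℓ)ᵒᵈ (ColWord N ℓ)ᵒᵈ ℚ)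
    (hE : ∀ i j, E i j = 0 ∨ 1 ≤ padicValRat 2 (E i j)) : IsUnit (levelMatrix N ℓ + E) := by
  classical
  have hdiag : ∀ j, (levelMatrix N ℓ + E) j j ≠ 0 ∧
      padicValRat 2 ((levelMatrix N ℓ + E) j j) =
        padicValRat 2 (zagierCoeff 0 (twosAfter N (OrderDual.ofDual j).1)) := by
    intro j
    rw [Matrix.add_apply, levelMatrix_diag]
    exact padicValRat_add_of_zero_or_one_le (zagierCoeff_ne_zero _ _)
      (padicValRat_zagierCoeff_le_zero _ _) (hE j j)
  refine lemma_7_1 2 (levelMatrix N ℓ + E) (fun i j hij => ?_) (fun i j => ?_) (fun j => ?_)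
  · -- (i) below the diagonal only `E` contributes
    rw [Matrix.add_apply, levelMatrix_below i j hij, zero_add]
    exact hE i j
  · -- (ii) the diagonal entry has the least valuation of its column
    rw [(hdiag j).2]
    by_cases hp : (OrderDual.ofDual j).1 <+: (OrderDual.ofDual i).1
    · right
      obtain ⟨hij, hab⟩ := levelMatrix_eq_zagierCoeff_of_prefix i j hp
      rw [Matrix.add_apply, hij, (padicValRat_add_of_zero_or_one_le (zagierCoeff_ne_zero _ _)
        (padicValRat_zagierCoeff_le_zero _ _) (hE i j)).2, ← hab]
      exact padicValRat_zagierCoeff_three_twos_le _ _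
    · rw [Matrix.add_apply, levelMatrix_eq_zero_of_not_prefix i j hp, zero_add]
      rcases hE i j with h | h
      · exact Or.inl h
      · right
        have := padicValRat_zagierCoeff_le_zero 0 (twosAfter N (OrderDual.ofDual j).1)
        omega
  · -- the diagonal entries: `≠ 0`, valuation `≤ 0`
    refine ⟨(hdiag j).1, ?_⟩
    rw [(hdiag j).2]
    exact padicValRat_zagierCoeff_le_zero _ _

/-- **`T_{N,ℓ}` is invertible** (the case `E = 0`). [cite: Brown2012, Theorem 7.3] -/
theorem isUnit_levelMatrix (N ℓ : ℕ) : IsUnit (levelMatrix N ℓ) := by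
  simpa using isUnit_levelMatrix_add N ℓ 0 (fun _ _ => Or.inl rfl)

/-! ### Lemma 3.8 / (3.11) for the coefficients: `∑_{a+b=n-1} c_{2^{a} 3 2^{b}} = (-1)^{n+1}` -/

/-- The even and odd halves of the binomial row `2n` (`n ≥ 1`):
`∑_{a ≤ n} C(2n, 2a) = ∑_{b < n} C(2n, 2b+1) = 2^{2n-1}`. [folklore] -/
theorem sum_choose_two_mul_even_odd (n : ℕ) (hn : 1 ≤ n) :
    (∑ a ∈ Finset.range (n + 1), (Nat.choose (2 * n) (2 * a) : ℚ)) = 2 ^ (2 * n - 1) ∧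
      (∑ b ∈ Finset.range n, (Nat.choose (2 * n) (2 * b + 1) : ℚ)) = 2 ^ (2 * n - 1) := by
  have htot : ∑ k ∈ Finset.range (2 * n + 1), (Nat.choose (2 * n) k : ℚ) = 2 ^ (2 * n) := by
    exact_mod_cast Nat.sum_range_choose (2 * n)
  have halt : ∑ k ∈ Finset.range (2 * n + 1), ((-1 : ℚ) ^ k * Nat.choose (2 * n) k) = 0 := by
    have h := Int.alternating_sum_range_choose (n := 2 * n)
    rw [if_neg (by omega)] at h
    exact_mod_cast h
  rw [Finset.sum_range_succ, sum_range_two_mul, Finset.sum_add_distrib] at htot halt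
  have he : ∀ j : ℕ, (-1 : ℚ) ^ (2 * j) = 1 := fun j => by rw [pow_mul, neg_one_sq, one_pow]
  have ho : ∀ j : ℕ, (-1 : ℚ) ^ (2 * j + 1) = -1 := fun j => by rw [pow_succ, he]; ring
  simp only [he, ho, one_mul, neg_one_mul, Finset.sum_neg_distrib] at halt
  have h2 : (2 : ℚ) ^ (2 * n) = 2 * 2 ^ (2 * n - 1) := by
    rw [← pow_succ', Nat.sub_add_cancel (by omega)]
  rw [Finset.sum_range_succ]
  constructor <;> linarith

/-- **Lemma 3.8 / (3.11) of Brown 2012 for the coefficients `c_w` of (4.2)**: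
`∑_{a+b=n-1} c_{2^{a} 3 2^{b}} = (-1)^{n+1}` for `n ≥ 1`, i.e. with (3.11),
`c_{12ⁿ} = -2 ∑ᵢ c_{2^{i} 3 2^{n-1-i}} = 2 (-1)ⁿ` — the statement of Lemma 3.8 (so `μ(C_{12ⁿ}) ∈ 2ℤ`,
as used in Theorem 7.3). [cite: Brown2012, Lemma 3.8 and (3.11)] -/
theorem sum_zagierCoeff_antidiagonal (n : ℕ) (hn : 1 ≤ n) :
    ∑ a ∈ Finset.range n, zagierCoeff a (n - 1 - a) = (-1) ^ (n + 1) := by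
  obtain ⟨hE, hO⟩ := sum_choose_two_mul_even_odd n hn
  have hterm : ∀ a ∈ Finset.range n, zagierCoeff a (n - 1 - a) =
      2 * (-1) ^ n * (Nat.choose (2 * n) (2 * a + 2) : ℚ) -
        2 * (-1) ^ n * (1 - ((2 : ℚ) ^ (2 * n))⁻¹) * Nat.choose (2 * n) (2 * (n - 1 - a) + 1) := by
    intro a ha
    rw [Finset.mem_range] at ha
    rw [zagierCoeff_def, show a + (n - 1 - a) + 1 = n by omega, zagierA_def, zagierB_def]
    ring
  rw [Finset.sum_congr rfl hterm, Finset.sum_sub_distrib, ← Finset.mul_sum, ← Finset.mul_sum]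
  -- the even sum without `C(2n, 0)` and the odd sum (reflected)
  have hE' : ∑ a ∈ Finset.range n, (Nat.choose (2 * n) (2 * a + 2) : ℚ) = 2 ^ (2 * n - 1) - 1 := by
    rw [Finset.sum_range_succ'] at hE
    simp only [mul_zero, Nat.choose_zero_right, Nat.cast_one] at hE
    have : ∑ a ∈ Finset.range n, (Nat.choose (2 * n) (2 * a + 2) : ℚ) =
        ∑ a ∈ Finset.range n, (Nat.choose (2 * n) (2 * (a + 1)) : ℚ) :=
      Finset.sum_congr rfl fun a _ => by rw [show 2 * a + 2 = 2 * (a + 1) by ring]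
    rw [this]
    linarith
  have hO' : ∑ a ∈ Finset.range n, (Nat.choose (2 * n) (2 * (n - 1 - a) + 1) : ℚ) = 2 ^ (2 * n - 1) := by
    rw [Finset.sum_range_reflect (fun b => (Nat.choose (2 * n) (2 * b + 1) : ℚ)) n, hO]
  rw [hE', hO']
  have h2 : (2 : ℚ) ^ (2 * n) = 2 * 2 ^ (2 * n - 1) := by
    rw [← pow_succ', Nat.sub_add_cancel (by omega)]
  have hne : (2 : ℚ) ^ (2 * n - 1) ≠ 0 := by positivity
  rw [h2]
  field_simp
  ring

end Brown2012

end Literature.NumberTheory.Transcendental
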